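import Summits.QuantumFields.BalabanUV.T4Continuum.Support.NE9RecordIneq126Chain
import Summits.QuantumFields.BalabanUV.T4Continuum.Support.NE9Lemma1Gain
import Summits.QuantumFields.BalabanUV.T4Continuum.Support.NE9ComplexEncoding

/-!
# NE9LevelCountsRecord — the species LEVEL COUNTS `LevelCountsG` ([II] (1.26)–(1.28) p. 8; the row owner's binder structure,
# `NE9Lemma1Gain`) PRODUCED for any piece frame READ ON THE CARRIERS OF RECORD `B13Carriers.TwoRuns.carriers`: the (1.26) field
# `sumX` KERNEL from the block-chain corner `NE9RecordIneq126Chain.ineq126_level_chain_144` (leaf-05-g4; κ ≥ 144 ⇒ O1 = m·(2²⁰ + 1))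
# and the (1.28) field `count0` KERNEL from NE5-P2's torus volume bound `B13DomainGeometryTR.volBound_level` (κ₁ ≥ 2 + 16·log 64,
# numeral corner κ₁ ≥ 69) — MODULO displayed O1-side identification binders; `cover`, `countQ` ((6L)⁴-count) and `sumY` ((1.27))
# displayed SEPARATELY (cell `pub-balaban`, T4-DAG §2 node U3 / §6 NE9; rung (B)+1 on a FIXED finite T⁴; NE9 formalisation swarm, unit
# `b2b-balaban-t4-ne9-formalise-leaf-01` gen 7, own-initiative lineage item «LC-REC», journal CLAIM l.11526; nothing of any import is
# modified)

HONEST FRAMING (T4-DAG PAGE 1).  Rung (B)+1 = existence and uniqueness of the ε → 0 limit of gauge-invariant observables on a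
FIXED finite torus T⁴ — NOT infinite volume, NOT a mass gap, NOT the Clay problem.  NE9 (`T4OutputRate.NE9` ∧ `FadingMemory`) is
a cell NEW ESTIMATE, NOT PRINTED and NOT discharged here («NE9 ⇐ the named binders»); spine 0/9; 0/18 skeleton leaves
instantiated on Bałaban's objects (O-NE9-1).  HONEST DEPENDENCY (cell line, verbatim): continuum YM on T⁴ ⇐ BetaPertH ∧ nine spine
estimates (0/9 proved); BetaPertH ⇐ (D1) ∧ (D4) ∧ CAP+tail; G-an2-4 gates asym, D1 and NE2/3/4.  `FlowStep.BetaPertH`, (B), (B^μ)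
do not occur.  [II] = [Balaban1988RG2Cluster] (CMP **116**) is quoted for TYPES only (ABSOLUTE RULE: nothing printed in the
audited series is asserted); (1.26) is printed *"for κ sufficiently large"* with an unspecified O(1), (1.27)/(1.28) with the
numerals quoted in `NE9Lemma1Counting.LevelCounts`.

WHERE THIS SITS.  Every S5 leaf of the species programme (`channelSizeAtStepNN_cur` / `_ker` / `_rem`, hence every species END face —
`NE9Lemma1CurveSpeciesEnd`, `NE9Lemma1SpeciesEnd(Additive)(Cur)`, E5′-REM, E5′-CUR, E5′-SUM, the MP and A3 read-outs …) DISPLAYS the level counts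
`LevelCountsG D.toC.frame κ κ₁ O1 c_Q gain ℓ` of the datum's piece frame: five fields — `cover` (the □′-cover of the sources),
`sumX` ((1.26): `Σ_{X ∈ 𝐃_j, X ⊃ □′} e^{−κ d_j(X)} ≤ O1`), `countQ` (the □′-count times the gain, *"(6L)⁴L^jη"*), `sumY` ((1.27): the
Y₀-sum `≤ e`), `count0` ((1.28): `#□₀ ≤ exp((1/16)(κ₁−2)·d_k(Y))`).  The typer's DAG §1D rows 8–9 record: *produced for toy frames
only; for a species frame: displayed*.  Two of the five are lattice sums/counts the cell has CERTIFIED on its periodic carrier: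
(1.26) at every scale through every cube with constant `2²⁰ + 1` from `κ ≥ 144` (leaf-05-g4's block chain, transported to the
carriers of record in `NE9RecordIneq126Chain`), and the cube count `#cubes(Y) ≤ 64·(1 + d(Y))` ((2.30) repaired, NE5-P2's
`B13DomainGeometryTR.volBound_level`).  THIS FILE feeds them into the owner's structure for ANY piece frame `P : PieceData C …` over
ANY carriers `C` READ on the carriers of record `R.carriers` (`R : TwoRuns G`):
* §1 `sum_comp_le_mul_sum` (finite combinatorics: a reading of multiplicity ≤ m transports a nonnegative sum with a factor m) and
  **`sumX_of_record`** — the (1.26) field: if the fibre `P.SX k y a j q` reads (along `rd : C.Dom → R.carriers.Dom`,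
  `C.d x = d (rd x)`, multiplicity ≤ m) into the scale-`j` domains whose footprint contains the counting cube `cube k y a j q`,
  then `Σ_{x ∈ P.SX k y a j q} e^{−κ·C.d x} ≤ m·(2²⁰ + 1)` for `κ ≥ 144`; `multiplicity_id_le_one` (plain reading, m = 1) and
  `multiplicity_fst_le_two` (the doubled carriers `NE9ComplexEncoding.doubleCarriers`, re/im copies, m = 2);
* §2 `mul_le_exp_mul` (`64·t ≤ e^{c·t}` for `t ≥ 1`, `c ≥ log 64`) and **`count0_of_record`** — the (1.28) field: if the boxes
  `P.S0 k y` inject into the footprint of an output domain `Yout k y` of the record and the frame's output size field dominates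
  `1 + d_k(Yout k y)`, then `#P.S0 k y ≤ exp((1/16)(κ₁−2)·P.dY k y)` for `κ₁ ≥ 2 + 16·log 64`; numeral corner
  `two_add_sixteen_log_64_lt : 2 + 16·log 64 < 69`;
* §3 **`levelCountsG_of_record`** — the structure ASSEMBLED: `sumX`, `count0` KERNEL as above (O1 := m·(2²⁰+1), κ ≥ 144, κ₁ ≥ 69),
  `cover` / `countQ` / `sumY` passed through as DISPLAYED hypotheses, each in the owner's field shape verbatim.
LOCATED CENSUS REMARK (numbers, not adjectives; record only — no binder of the row is claimed false).  On the carriers of record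
`d_k(Y) = torusTreeLen = 0` holds for every torus-face-connected family inside one vertex block — up to 2⁴ cubes
(`NE9TorusSizeDichotomy.exists_block_of_torusTreeLen_eq_zero`; the `d = 0` class through a cube has up to `2⁴·2^(2⁴)` members,
`card_filter_torusTreeLen_eq_zero_le`) — so the field `count0` with the output size read VERBATIM as `P.dY k y := d_k(Y)` is
UNSATISFIABLE as soon as such a `Y` carries ≥ 2 boxes □₀ (`2 ≤ e⁰` is false); print's (1.28) *"M⁻⁴|Y| ≦ 3·2³d_k(Y)"* has the same
zero-size corner (cf. the cell's repaired (2.30), GAPS G-B13-07: `M⁻⁴|Y| ≤ 24(⌊d⌋ + 1)`).  The frame's FREE field `dY` read as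
`1 + d_k(Y)` repairs it at the price of the factor `e^{−κ₁/16}` in `weightOf` (which reads `exp(−(1/16)κ₁·dY)`); hence the
identification binder `1 + d_k(Yout k y) ≤ P.dY k y` of §2, displayed.  DISGUISE TEST: lattice bookkeeping on the cell's torus model
composed BY NAME with leaf-05-g4's and NE5-P2's geometry; the readings `rd` / `cube` / `Yout` of a species frame on Bałaban's (1.33)
objects are O-NE9-1; no activity, no history — not NE9, not NE5.

References (TYPES only): T. Bałaban, *Renormalization group approach to lattice gauge field theories. II. Cluster expansions*,
Commun. Math. Phys. **116** (1988) 1–22 [Balaban1988RG2Cluster], (1.26)–(1.28) p. 8, (2.30) p. 18; *I*, Commun. Math. Phys. **109**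
(1987) 249–301 [Balaban1987RG1], (0.24)–(0.26) p. 257 (the periodic carrier and its cubes).  Summits-side NEW work (LEAN PLACEMENT
RULE); imports `NE9RecordIneq126Chain` (p213514, leaf-05-g4), `NE9Lemma1Gain` (owner, N49) and `NE9ComplexEncoding` (owner,
p209236) ONLY; modifies nothing; 0 `def`, 0 `def … : Prop`, 0 sorry.  Value = bookkeeping: two of the five displayed counting
fields of every species END become kernel on the carriers of record with the cell's certified constants, NOT summit progress.
-/

noncomputable section

open scoped BigOperators

namespace Summit.QuantumFields.BalabanUV.T4Continuum.NE9LevelCountsRecord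

open Literature.MathematicalPhysics.QuantumFieldTheory.Balaban1983to89
open Literature.MathematicalPhysics.QuantumFieldTheory.Balaban1983to89.T4OutputRate (Carriers)
open Literature.MathematicalPhysics.QuantumFieldTheory.Balaban1983to89.B13FamilySum (Ineq126 VolBound)
open Summit.QuantumFields.BalabanUV.T4Continuum.B13Carriers (TwoRuns)
open Summit.QuantumFields.BalabanUV.T4Continuum.B13DomainGeometryTR
open Summit.QuantumFields.BalabanUV.T4Continuum.NE9RecordIneq126Chain (ineq126_level_chain_144)
open Summit.QuantumFields.BalabanUV.T4Continuum.NE9ComplexEncoding (doubleCarriers)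
open Summit.QuantumFields.BalabanUV.T4Continuum.NE9Lemma1Counting
open Summit.QuantumFields.BalabanUV.T4Continuum.NE9Lemma1Gain

/-! ## §1 The (1.26) field `sumX` on the carriers of record -/

section Fibre

/-- Finite combinatorics: a reading `r : X → Y` of multiplicity ≤ `m` over `t` transports a nonnegative sum on `t` with the
factor `m`: `Σ_{x ∈ s} f(r x) ≤ m·Σ_{y ∈ t} f y` when `r` maps `s` into `t`. [folklore] -/
theorem sum_comp_le_mul_sum {X Y : Type*} [DecidableEq Y] (s : Finset X) (t : Finset Y) (r : X → Y) (f : Y → ℝ)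
    (hf : ∀ y ∈ t, 0 ≤ f y) (hmaps : ∀ x ∈ s, r x ∈ t) {m : ℕ}
    (hm : ∀ y ∈ t, (((s.filter fun x => r x = y).card : ℕ) : ℝ) ≤ m) :
    ∑ x ∈ s, f (r x) ≤ (m : ℝ) * ∑ y ∈ t, f y := by
  classical
  rw [← Finset.sum_fiberwise_of_maps_to hmaps (f := fun x => f (r x)), Finset.mul_sum]
  refine Finset.sum_le_sum fun y hy => ?_
  have hconst : ∑ x ∈ s.filter (fun x => r x = y), f (r x) = (((s.filter fun x => r x = y).card : ℕ) : ℝ) * f y := by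
    rw [Finset.sum_congr rfl (fun x hx => by rw [(Finset.mem_filter.1 hx).2] :
      ∀ x ∈ s.filter (fun x => r x = y), f (r x) = f y), Finset.sum_const, nsmul_eq_mul]
  rw [hconst]
  exact mul_le_mul_of_nonneg_right (hm y hy) (hf y hy)

/-- The identity reading has multiplicity ≤ 1. [folklore] -/
theorem multiplicity_id_le_one {Y : Type*} [DecidableEq Y] (s : Finset Y) (y : Y) :
    (((s.filter fun x => x = y).card : ℕ) : ℝ) ≤ (1 : ℕ) := by
  have h : (s.filter fun x => x = y) ⊆ {y} := fun x hx => by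
    rw [Finset.mem_singleton]; exact (Finset.mem_filter.1 hx).2
  exact_mod_cast (Finset.card_le_card h).trans (Finset.card_singleton y).le

/-- The re/im reading `Prod.fst` of the DOUBLED carriers (`NE9ComplexEncoding.doubleCarriers`: every domain in two copies) has
multiplicity ≤ 2. [folklore] -/
theorem multiplicity_fst_le_two {Y : Type*} [DecidableEq Y] (s : Finset (Y × Bool)) (y : Y) :
    (((s.filter fun x => x.1 = y).card : ℕ) : ℝ) ≤ (2 : ℕ) := by
  classical
  have h : (s.filter fun x => x.1 = y) ⊆ (Finset.univ : Finset Bool).image fun b => (y, b) := by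
    intro x hx
    rw [Finset.mem_image]
    refine ⟨x.2, Finset.mem_univ _, ?_⟩
    rw [← (Finset.mem_filter.1 hx).2]
  have h2 : ((Finset.univ : Finset Bool).image fun b => (y, b)).card ≤ 2 :=
    Finset.card_image_le.trans (by simp)
  exact_mod_cast (Finset.card_le_card h).trans h2

end Fibre

section Record

variable {G : Type} [GaugeGroup G] (R : TwoRuns G)
variable {C : Carriers} {Bg ι α β γ : Type}

/-- **THE (1.26) FIELD `sumX` OF THE LEVEL COUNTS ON THE CARRIERS OF RECORD.**  For a piece frame `P` over carriers `C` READ on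
the carriers of record along `rd` (sizes preserved: `C.d x = d (rd x)`; multiplicity ≤ `m` on each fibre — `m = 1` for the
identity reading, `m = 2` for the re/im reading of the doubled carriers, §1), whose fibre `P.SX k y a j q` over the counting cube
`□′ = cube k y a j q` reads into the scale-`j` localization domains whose footprint CONTAINS `□′` (the displayed O1-side
identification: *"X ∈ 𝐃_j, X ⊃ □′"*), the (1.26) sum is bounded by `m·(2²⁰ + 1)` as soon as `κ ≥ 144` — leaf-05-g4's block-chain
corner `NE9RecordIneq126Chain.ineq126_level_chain_144` BY NAME. [cite: Balaban1988RG2Cluster, (1.26) p.8] -/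
theorem sumX_of_record (P : PieceData C Bg ι α β γ) (rd : C.Dom → R.carriers.Dom)
    (hd : ∀ x, C.d x = R.carriers.d (rd x)) {m : ℕ}
    (hm : ∀ (k : ℕ) (y : ι) (a : α) (j : ℕ) (q : γ) (Y : R.carriers.Dom),
      ((((P.SX k y a j q).filter fun x => rd x = Y).card : ℕ) : ℝ) ≤ m)
    (cube : ℕ → ι → α → ℕ → γ → SCube R)
    (hSX : ∀ (k : ℕ) (y : ι) (a : α) (j : ℕ) (q : γ), ∀ x ∈ P.SX k y a j q,
      rd x ∈ R.domAt j ∧ cube k y a j q ∈ footprint (rd x))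
    {κ : ℝ} (hκ : 144 ≤ κ) (k : ℕ) (y : ι) (a : α) (j : ℕ) (q : γ) :
    ∑ x ∈ P.SX k y a j q, Real.exp (-(κ * C.d x)) ≤ (m : ℝ) * (2 ^ 20 + 1) := by
  classical
  have h126 : ∑ Y ∈ (R.domAt j).filter (fun Y => cube k y a j q ∈ footprint Y), Real.exp (-(κ * R.carriers.d Y))
      ≤ 2 ^ 20 + 1 := ineq126_level_chain_144 R j hκ (cube k y a j q)
  calc ∑ x ∈ P.SX k y a j q, Real.exp (-(κ * C.d x))
      = ∑ x ∈ P.SX k y a j q, Real.exp (-(κ * R.carriers.d (rd x))) := Finset.sum_congr rfl fun x _ => by rw [hd x]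
    _ ≤ (m : ℝ) * ∑ Y ∈ (R.domAt j).filter (fun Y => cube k y a j q ∈ footprint Y), Real.exp (-(κ * R.carriers.d Y)) :=
        sum_comp_le_mul_sum (P.SX k y a j q) _ rd (fun Y => Real.exp (-(κ * R.carriers.d Y)))
          (fun _ _ => (Real.exp_pos _).le) (fun x hx => Finset.mem_filter.2 (hSX k y a j q x hx)) (fun Y _ => hm k y a j q Y)
    _ ≤ (m : ℝ) * (2 ^ 20 + 1) := mul_le_mul_of_nonneg_left h126 (Nat.cast_nonneg m)

/-! ## §2 The (1.28) field `count0` on the carriers of record -/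

/-- Real arithmetic: `64·t ≤ e^{c·t}` for `t ≥ 1` and `c ≥ log 64` (`e^{c} ≥ 64`, `e^{c(t−1)} ≥ 1 + c(t−1) ≥ t` as `c ≥ 1`).
[folklore] -/
theorem mul_le_exp_mul {c t : ℝ} (hc : Real.log 64 ≤ c) (ht : 1 ≤ t) : 64 * t ≤ Real.exp (c * t) := by
  have hlog1 : (1 : ℝ) ≤ Real.log 64 := by
    rw [← Real.log_exp 1]
    exact Real.log_le_log (Real.exp_pos 1) (by have := Real.exp_one_lt_d9; linarith)
  have hc1 : 1 ≤ c := hlog1.trans hc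
  have h64 : (64 : ℝ) ≤ Real.exp c := by
    calc (64 : ℝ) = Real.exp (Real.log 64) := (Real.exp_log (by norm_num)).symm
      _ ≤ Real.exp c := Real.exp_le_exp.2 hc
  have ht' : t ≤ Real.exp (c * (t - 1)) := by
    have h1 := Real.add_one_le_exp (c * (t - 1))
    nlinarith
  calc 64 * t ≤ Real.exp c * Real.exp (c * (t - 1)) := mul_le_mul h64 ht' (by linarith) (Real.exp_pos c).le
    _ = Real.exp (c * t) := by rw [← Real.exp_add]; ring_nf

/-- Numeral corner: `2 + 16·log 64 < 69` (`log 64 = 6·log 2 < 6·0.6931471808`). [folklore] -/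
theorem two_add_sixteen_log_64_lt : 2 + 16 * Real.log 64 < 69 := by
  have h : Real.log 64 = 6 * Real.log 2 := by
    rw [show (64 : ℝ) = 2 ^ 6 by norm_num, Real.log_pow]; norm_num
  rw [h]
  have := Real.log_two_lt_d9
  linarith

/-- **THE (1.28) FIELD `count0` OF THE LEVEL COUNTS ON THE CARRIERS OF RECORD.**  If the boxes `P.S0 k y` of the output index
inject into the footprint (the cubes) of an output domain `Yout k y` of the record (displayed O1-side identification: *"□₀ ⊂ Y"*)
and the frame's output size field DOMINATES `1 + d_k(Yout k y)` (the located repair of the zero-size corner, see the module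
docstring), then `#P.S0 k y ≤ exp((1/16)(κ₁−2)·P.dY k y)` for `κ₁ ≥ 2 + 16·log 64` — NE5-P2's torus volume bound
`B13DomainGeometryTR.volBound_level` (`#cubes ≤ 64·(1 + d)`) BY NAME and §2's arithmetic. [cite: Balaban1988RG2Cluster, (1.28) p.8, (2.30) p.18] -/
theorem count0_of_record (P : PieceData C Bg ι α β γ) (Yout : ℕ → ι → R.carriers.Dom)
    (hS0 : ∀ (k : ℕ) (y : ι), (P.S0 k y).card ≤ (footprint (Yout k y)).card)
    (hdY : ∀ (k : ℕ) (y : ι), 1 + R.carriers.d (Yout k y) ≤ P.dY k y)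
    {κ₁ : ℝ} (hκ₁ : 2 + 16 * Real.log 64 ≤ κ₁) (k : ℕ) (y : ι) :
    ((P.S0 k y).card : ℝ) ≤ Real.exp ((1 / 16) * (κ₁ - 2) * P.dY k y) := by
  have hvol : ((footprint (Yout k y)).card : ℝ) ≤ 64 * (1 + R.carriers.d (Yout k y)) :=
    volBound_level (R := R) (R.carriers.scale (Yout k y)) (Yout k y) ((TwoRuns.mem_domAt R).2 rfl)
  have ht : 1 ≤ 1 + R.carriers.d (Yout k y) := by have := R.carriers.d_nonneg (Yout k y); linarith
  have hc : Real.log 64 ≤ (1 / 16) * (κ₁ - 2) := by linarith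
  have hc0 : 0 ≤ (1 / 16) * (κ₁ - 2) := by
    have : 0 ≤ Real.log 64 := Real.log_nonneg (by norm_num)
    linarith
  calc ((P.S0 k y).card : ℝ) ≤ ((footprint (Yout k y)).card : ℝ) := by exact_mod_cast hS0 k y
    _ ≤ 64 * (1 + R.carriers.d (Yout k y)) := hvol
    _ ≤ Real.exp ((1 / 16) * (κ₁ - 2) * (1 + R.carriers.d (Yout k y))) := mul_le_exp_mul hc ht
    _ ≤ Real.exp ((1 / 16) * (κ₁ - 2) * P.dY k y) :=
        Real.exp_le_exp.2 (mul_le_mul_of_nonneg_left (hdY k y) hc0)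

/-! ## §3 The structure assembled: two fields kernel, three displayed -/

/-- **THE SPECIES LEVEL COUNTS ON THE CARRIERS OF RECORD** — the owner's `LevelCountsG P κ κ₁ O1 c_Q gain ℓ` PRODUCED for any
piece frame `P` read on the carriers of record, with `O1 := m·(2²⁰ + 1)`: the (1.26) field `sumX` by `sumX_of_record` (κ ≥ 144;
leaf-05-g4's block chain) and the (1.28) field `count0` by `count0_of_record` (κ₁ ≥ 69 ≥ 2 + 16·log 64; NE5-P2's volume bound),
modulo the displayed O1-side IDENTIFICATION binders (`rd`/`hd`/`hm`: the reading and its multiplicity; `cube`/`hSX`: the fibres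
read *"X ∈ 𝐃_j, X ⊃ □′"*; `Yout`/`hS0`/`hdY`: the boxes read *"□₀ ⊂ Y"* and the output size field read `≥ 1 + d_k(Y)`), and with
the three remaining fields DISPLAYED SEPARATELY in the owner's shapes verbatim: `hcover` (the □′-cover of the sources), `hcountQ`
(the □′-count against the gain, *"(6L)⁴L^jη"*), `hsumY` ((1.27), the Y₀-sum `≤ e`).
[cite: Balaban1988RG2Cluster, (1.26)-(1.28) p.8, (2.30) p.18] -/
theorem levelCountsG_of_record (P : PieceData C Bg ι α β γ) {κ κ₁ cQ : ℝ} {gain ℓ : ℕ → ℕ → ℝ}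
    -- the reading of the frame's carriers on the record and its multiplicity
    (rd : C.Dom → R.carriers.Dom) (hd : ∀ x, C.d x = R.carriers.d (rd x)) {m : ℕ}
    (hm : ∀ (k : ℕ) (y : ι) (a : α) (j : ℕ) (q : γ) (Y : R.carriers.Dom),
      ((((P.SX k y a j q).filter fun x => rd x = Y).card : ℕ) : ℝ) ≤ m)
    -- (1.26) side: the fibres read "X ∈ 𝐃_j, X ⊃ □′"
    (cube : ℕ → ι → α → ℕ → γ → SCube R)
    (hSX : ∀ (k : ℕ) (y : ι) (a : α) (j : ℕ) (q : γ), ∀ x ∈ P.SX k y a j q,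
      rd x ∈ R.domAt j ∧ cube k y a j q ∈ footprint (rd x))
    (hκ : 144 ≤ κ)
    -- (1.28) side: the boxes read "□₀ ⊂ Y", the output size field read "≥ 1 + d_k(Y)"
    (Yout : ℕ → ι → R.carriers.Dom)
    (hS0 : ∀ (k : ℕ) (y : ι), (P.S0 k y).card ≤ (footprint (Yout k y)).card)
    (hdY : ∀ (k : ℕ) (y : ι), 1 + R.carriers.d (Yout k y) ≤ P.dY k y) (hκ₁ : 69 ≤ κ₁)
    -- displayed: cover, □′-count, (1.27)
    (hcover : ∀ (k : ℕ) (y : ι) (a : α) (j : ℕ), ∀ x ∈ P.src k y a j, ∃ q ∈ P.Sq k y a j, x ∈ P.SX k y a j q)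
    (hcountQ : ∀ (k : ℕ) (y : ι) (a : α) (j : ℕ), ((P.Sq k y a j).card : ℝ) * gain k j ≤ cQ * ℓ k j)
    (hsumY : ∀ (k : ℕ) (y : ι), ∀ a ∈ P.S0 k y,
      ∑ b ∈ P.SY k y a, Real.exp (-(1 / 2) * (κ₁ - 1) * P.vol k y a b) ≤ Real.exp 1) :
    LevelCountsG P κ κ₁ ((m : ℝ) * (2 ^ 20 + 1)) cQ gain ℓ where
  cover := hcover
  sumX := fun k y a j q _ => sumX_of_record R P rd hd hm cube hSX hκ k y a j q
  countQ := hcountQ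
  sumY := hsumY
  count0 := count0_of_record R P Yout hS0 hdY (by have := two_add_sixteen_log_64_lt; linarith) 

/-- **COROLLARY (plain reading).**  A piece frame over the carriers of record THEMSELVES (`C := R.carriers`, `rd := id`, m = 1):
`O1 = 2²⁰ + 1`. [cite: Balaban1988RG2Cluster, (1.26)-(1.28) p.8] -/
theorem levelCountsG_of_record_id (P : PieceData R.carriers Bg ι α β γ) {κ κ₁ cQ : ℝ} {gain ℓ : ℕ → ℕ → ℝ}
    (cube : ℕ → ι → α → ℕ → γ → SCube R)
    (hSX : ∀ (k : ℕ) (y : ι) (a : α) (j : ℕ) (q : γ), ∀ x ∈ P.SX k y a j q,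
      x ∈ R.domAt j ∧ cube k y a j q ∈ footprint x)
    (hκ : 144 ≤ κ) (Yout : ℕ → ι → R.carriers.Dom)
    (hS0 : ∀ (k : ℕ) (y : ι), (P.S0 k y).card ≤ (footprint (Yout k y)).card)
    (hdY : ∀ (k : ℕ) (y : ι), 1 + R.carriers.d (Yout k y) ≤ P.dY k y) (hκ₁ : 69 ≤ κ₁)
    (hcover : ∀ (k : ℕ) (y : ι) (a : α) (j : ℕ), ∀ x ∈ P.src k y a j, ∃ q ∈ P.Sq k y a j, x ∈ P.SX k y a j q)
    (hcountQ : ∀ (k : ℕ) (y : ι) (a : α) (j : ℕ), ((P.Sq k y a j).card : ℝ) * gain k j ≤ cQ * ℓ k j)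
    (hsumY : ∀ (k : ℕ) (y : ι), ∀ a ∈ P.S0 k y,
      ∑ b ∈ P.SY k y a, Real.exp (-(1 / 2) * (κ₁ - 1) * P.vol k y a b) ≤ Real.exp 1) :
    LevelCountsG P κ κ₁ (2 ^ 20 + 1) cQ gain ℓ := by
  classical
  have h := levelCountsG_of_record R P id (fun _ => rfl) (m := 1)
    (fun k y a j q Y => multiplicity_id_le_one (P.SX k y a j q) Y) cube hSX hκ Yout hS0 hdY hκ₁ hcover hcountQ hsumY
  simpa using h

/-- **COROLLARY (re/im reading).**  A piece frame over the DOUBLED carriers of record (`C := doubleCarriers R.carriers` — the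
carriers of every species channel of the NE9 programme, `NE9ComplexEncoding`; `rd := Prod.fst`, m = 2): `O1 = 2·(2²⁰ + 1)`.
[cite: Balaban1988RG2Cluster, (1.26)-(1.28) p.8; Balaban1987RG1, (0.24)-(0.25) p.257] -/
theorem levelCountsG_of_record_double (P : PieceData (doubleCarriers R.carriers) Bg ι α β γ) {κ κ₁ cQ : ℝ}
    {gain ℓ : ℕ → ℕ → ℝ} (cube : ℕ → ι → α → ℕ → γ → SCube R)
    (hSX : ∀ (k : ℕ) (y : ι) (a : α) (j : ℕ) (q : γ), ∀ x ∈ P.SX k y a j q,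
      x.1 ∈ R.domAt j ∧ cube k y a j q ∈ footprint x.1)
    (hκ : 144 ≤ κ) (Yout : ℕ → ι → R.carriers.Dom)
    (hS0 : ∀ (k : ℕ) (y : ι), (P.S0 k y).card ≤ (footprint (Yout k y)).card)
    (hdY : ∀ (k : ℕ) (y : ι), 1 + R.carriers.d (Yout k y) ≤ P.dY k y) (hκ₁ : 69 ≤ κ₁)
    (hcover : ∀ (k : ℕ) (y : ι) (a : α) (j : ℕ), ∀ x ∈ P.src k y a j, ∃ q ∈ P.Sq k y a j, x ∈ P.SX k y a j q)
    (hcountQ : ∀ (k : ℕ) (y : ι) (a : α) (j : ℕ), ((P.Sq k y a j).card : ℝ) * gain k j ≤ cQ * ℓ k j)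
    (hsumY : ∀ (k : ℕ) (y : ι), ∀ a ∈ P.S0 k y,
      ∑ b ∈ P.SY k y a, Real.exp (-(1 / 2) * (κ₁ - 1) * P.vol k y a b) ≤ Real.exp 1) :
    LevelCountsG P κ κ₁ (2 * (2 ^ 20 + 1)) cQ gain ℓ := by
  classical
  have h := levelCountsG_of_record R P Prod.fst (fun _ => rfl) (m := 2)
    (fun k y a j q Y => multiplicity_fst_le_two (P.SX k y a j q) Y) cube hSX hκ Yout hS0 hdY hκ₁ hcover hcountQ hsumY
  simpa using h

end Record

end Summit.QuantumFields.BalabanUV.T4Continuum.NE9LevelCountsRecord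

end
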